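/-
Origin: expansion seat `prover-pub-hodgecm-mc-carch-1-g4-0`, handover #CA45 r2 2026-08-20T10:40Z md5 089083ca3bab (283 l., 18 decls; NEW additive leaf; imports installed RUN-44 #CA26 Model.ArchKTypeOfFinChar + glue-2's K-1 row #K370 HodgeCM.Vendored.H21.NumberTheory.GelbartRogawski1991.UnitaryDualPairSeesawCMLinesConjDeepLevelFixed (NOT in PKG yet); RUN 49; INSTALL only after #K370, else DROP #CA45 alone; cert certs/ax-ArchKTypeOfFinChar34-089083ca3bab.log: rc 0 / 47 s / 0 warnings / trio over my private vendored copy 77ea6f46da9e) (`HOME/mc/pub-hodgecm-mc-carch-1/pkg49/HodgeCM/Model/ArchKTypeOfFinChar34.lean`, md5 089083ca3bab, 283 lines);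
landed by the gen-19 packager (p-g19) in gate run 49 as `HodgeCM/Model/ArchKTypeOfFinChar34.lean` (verbatim).
-/
/-
Copyright (c) 2026. Released under Apache 2.0 license as described in the file LICENSE.
Cell pub-hodgecm, MODEL layer (construction prover mc-carch-1, gen 4), BINDER-OWNERS row 12 `C`, residual (D-2)/`hfin` for the
CONJUGATED-plane lines k = 2, 3 at the G pins, at ANY centre: the (34) twin of RUN-44 #CA26 `ArchKTypeOfFinChar`.
-/
import Summits.HodgeConjecture.HodgeCM.Model.ArchKTypeOfFinChar
import Literature.NumberTheory.GelbartRogawski1991.UnitaryDualPairSeesawCMLinesConjDeepLevelFixed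

/-!
# `hfin` for lines 2 and 3 on deep levels, any centre: `hfin_two/three_deepLevelG (x) (N)`

Verbatim #CA26 on the conjugated-plane lines (K-1's `…cmConjLineRepFin₀/₁_thinCosetTestFunₗ_eq_self`, tree
`Literature/NumberTheory/GelbartRogawski1991/UnitaryDualPairSeesawCMLinesConjDeepLevelFixed`, vendored twin): `lineRepOf_two/three_regime_finAdelicG`,
`exists_deepFix_twoG/threeG` (Weil's majorants: the big pair's `…cmPairSplitting_of_signs_two` under the plane sign `h₁W`, the two conj line
pairs' `…pairSmall₁/₂_lineVec_of_signs` at `hGR₂/hGR₃` — no line-sign hypothesis), the indices of record `deepIndexTwoG/ThreeG … x N`, and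
**`hfin_two/three_deepLevelG … (x) (N) (hM) (hdvd)`** — LITERALLY the `hfin` input of #CA43 `archKTypeOfSlotTwoAtG/ThreeAtG` at the centre
`x` on every deep level `deepLevel V M`.
Nothing is cited and nothing is minted; 0 records, 0 `def … : Prop`.
-/

set_option autoImplicit false

noncomputable section

open Filter Topology Complex
open NumberField NumberField.InfinitePlace NumberField.mixedEmbedding IsDedekindDomain MeasureTheory
open scoped Matrix TensorProduct Classical SchwartzMap
open MulAction
open Literature.Geometry.ComplexHyperbolic.BallModel (U21 x₀ stabilizerEquivK21)
open Literature.AlgebraicGeometry.HodgeTheory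
open Literature.AlgebraicGeometry.ShimuraVarieties
open Literature.NumberTheory.Automorphic Literature.NumberTheory.Weil1964
open Literature.NumberTheory.GelbartRogawski1991 Literature.NumberTheory.GelbartRogawski1991.UnitaryDualPair
open Literature.NumberTheory.Automorphic.PicardCM
open HodgeCM.Adelic HodgeCM.PerL34 HodgeCM.Model.HypCensus HodgeCM.Model.SupplyInstance HodgeCM.Model.ArchSideTerm

namespace HodgeCM.Model
section FinChar

variable {L : CMField} {ι₁ : L →+* ℂ} (V : HermSpace3 L ι₁) (S : StubTree.SeesawDatum L)
variable
  (hGR : (cmSplittingDatum (L : Type) finProdFinEquiv (frameD V) (frameD_real V) (frameD_ne V) (dW S) (dW_real S) (dW_ne S)).CompatibleSplitting)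
  (hGR₀ : (cmSplittingDatum (L : Type) (e₁) (frameD V) (frameD_real V) (frameD_ne V) (lineVec (L : Type) (dW S 0))
    (fun _ => dW_real S 0) (fun _ => dW_ne S 0)).CompatibleSplitting)
  (hGR₁ : (cmSplittingDatum (L : Type) (e₁) (frameD V) (frameD_real V) (frameD_ne V) (lineVec (L : Type) (dW S 1))
    (fun _ => dW_real S 1) (fun _ => dW_ne S 1)).CompatibleSplitting)
  (hGR₂ : (cmSplittingDatum (L : Type) (e₁) (frameD V) (frameD_real V) (frameD_ne V) (lineVec (L : Type) (dW' S 0))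
    (fun _ => dW'_real S 0) (fun _ => dW'_ne S 0)).CompatibleSplitting)
  (hGR₃ : (cmSplittingDatum (L : Type) (e₁) (frameD V) (frameD_real V) (frameD_ne V) (lineVec (L : Type) (dW' S 1))
    (fun _ => dW'_real S 1) (fun _ => dW'_ne S 1)).CompatibleSplitting)
  (η₀ η₁ η₂ η₃ : CMAdelic (L : Type) (frameD V) × CMAdelicOne (L : Type) →* ℂˣ)
  (hV : IsAnisotropic L V.Hm)

/-- **line 2**: `lineRepOf 2 (regimeEquiv hV (1, k_f), 1) = cmConjLineRepFin₀ η₂ ((1, finFrameCongr k_f), 1)`. -/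
theorem lineRepOf_two_regime_finAdelicG
    (kf : UnitaryGroup.finAdelic (↥(maximalRealSubfield L)) L (IsCMField.complexConj L) 3 V.Hm) :
    lineRepOf V S hGR hGR₀ hGR₁ hGR₂ hGR₃ η₀ η₁ η₂ η₃ 2
        (HodgeCM.Adelic.regimeEquiv L V.Hm hV
          (UnitaryGroup.finAdelicToAdelic (↥(maximalRealSubfield L)) L (IsCMField.complexConj L) 3 V.Hm kf), 1) =
      cmConjLineRepFin₀ (L : Type) finProdFinEquiv e₁ (frameD V) (frameD_real V) (frameD_ne V) (dW S) (dW_real S) (dW_ne S) (dW' S) (dW'_real S)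
        (dW'_ne S) S.isoGL (isoGL_hg₀ S) hGR hGR₂ hGR₃ η₂
        (UnitaryGroup.finAdelicToAdelic (↥(maximalRealSubfield L)) L (IsCMField.complexConj L) 3 (Matrix.diagonal (frameD V))
          (finFrameCongr (L : Type) V.Hm (frameG V) (frameD V) (frame_congr V) kf), 1) := by
  rw [← cmFrameEquiv_regime_finAdelicToAdelic V hV kf]
  rfl

/-- **line 3**: `lineRepOf 3 (regimeEquiv hV (1, k_f), 1) = cmConjLineRepFin₁ η₃ ((1, finFrameCongr k_f), 1)`. -/
theorem lineRepOf_three_regime_finAdelicG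
    (kf : UnitaryGroup.finAdelic (↥(maximalRealSubfield L)) L (IsCMField.complexConj L) 3 V.Hm) :
    lineRepOf V S hGR hGR₀ hGR₁ hGR₂ hGR₃ η₀ η₁ η₂ η₃ 3
        (HodgeCM.Adelic.regimeEquiv L V.Hm hV
          (UnitaryGroup.finAdelicToAdelic (↥(maximalRealSubfield L)) L (IsCMField.complexConj L) 3 V.Hm kf), 1) =
      cmConjLineRepFin₁ (L : Type) finProdFinEquiv e₁ (frameD V) (frameD_real V) (frameD_ne V) (dW S) (dW_real S) (dW_ne S) (dW' S) (dW'_real S)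
        (dW'_ne S) S.isoGL (isoGL_hg₀ S) hGR hGR₂ hGR₃ η₃
        (UnitaryGroup.finAdelicToAdelic (↥(maximalRealSubfield L)) L (IsCMField.complexConj L) 3 (Matrix.diagonal (frameD V))
          (finFrameCongr (L : Type) V.Hm (frameG V) (frameD V) (frame_congr V) kf), 1) := by
  rw [← cmFrameEquiv_regime_finAdelicToAdelic V hV kf]
  rfl

/-- **(D-2) FOR LINE 2 in `U(diag frameD V)(𝔸_f)` currency** (the K-1 twin of the tree theorem at the pin's data; `hV`-free): under the
plane sign `h₁W` at `ι₁` (Weil's majorants, vendored `…CMLinesMajorants` `_of_signs`) and continuity of `η`, for every base point `x` and test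
level `N` there is `n₀ ≠ 0` such that every `k ∈ K_{U(diag frameD V),f}(M)`, `n₀ ∣ M ≠ 0`, fixes every `φ_N(Φ_∞)` under `cmConjLineRepFin₀ η₂`.
[tree: GelbartRogawski1991 §3.1 Remark p. 457; Weil1964 n° 41 Thm 6] -/
theorem exists_deepFix_twoG (hη₂c : Continuous fun p => ((η₂ p : ℂˣ) : ℂ))
    (h₁W : (∀ j, 0 < (ι₁ (dW S j)).re) ∨ ∀ j, (ι₁ (dW S j)).re < 0)
    (x : Fin 3 → ↥(maximalRealSubfield L)) (N : ℕ) :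
    ∃ n₀ : ℕ, n₀ ≠ 0 ∧ ∀ M : ℕ, M ≠ 0 → n₀ ∣ M →
      ∀ k ∈ UnitaryGroup.finCongruenceLevel (↥(maximalRealSubfield L)) (L : Type) (IsCMField.complexConj L) 3
          (Matrix.diagonal (frameD V)) (Ideal.span {(M : 𝓞 L)}),
        ∀ Φinf : 𝓢((Fin 3 → mixedSpace (↥(maximalRealSubfield L))), ℂ),
          cmConjLineRepFin₀ (L : Type) finProdFinEquiv e₁ (frameD V) (frameD_real V) (frameD_ne V) (dW S) (dW_real S) (dW_ne S) (dW' S) (dW'_real S)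
              (dW'_ne S) S.isoGL (isoGL_hg₀ S) hGR hGR₂ hGR₃ η₂
              (UnitaryGroup.finAdelicToAdelic (↥(maximalRealSubfield L)) L (IsCMField.complexConj L) 3 (Matrix.diagonal (frameD V)) k, 1)
              (testFun (↥(maximalRealSubfield L)) (Fin 3) Φinf x N) =
            testFun (↥(maximalRealSubfield L)) (Fin 3) Φinf x N := by
  obtain ⟨n₀, hn₀, hfix⟩ :=
    exists_nat_forall_dvd_finCongruenceLevel_forall_cmConjLineRepFin₀_thinCosetTestFunₗ_eq_self (L : Type) finProdFinEquiv e₁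
      (frameD V) (frameD_real V) (frameD_ne V) (dW S) (dW_real S) (dW_ne S) (dW' S) (dW'_real S) (dW'_ne S) S.isoGL (isoGL_hg₀ S)
      hGR hGR₂ hGR₃ η₂
      (hasThetaMajorants_cmPairSplitting_of_signs_two (L : Type) finProdFinEquiv (frameD V) (frameD_real V) (frameD_ne V) (dW S)
        (dW_real S) (dW_ne S) ι₁ hGR (frameD_sign_ι₁' V) h₁W (frameD_sign_of_ne V))
      (hasThetaMajorants_omega_pairSmall₁_lineVec_of_signs (L : Type) e₁ (frameD V) (frameD_real V) (frameD_ne V) (dW' S 0)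
        (dW'_real S 0) (dW'_ne S 0) hGR₂ ι₁ (frameD_sign_ι₁' V) (frameD_sign_of_ne V))
      (hasThetaMajorants_omega_pairSmall₂_lineVec_of_signs (L : Type) e₁ (frameD V) (frameD_real V) (frameD_ne V) (dW' S 1)
        (dW'_real S 1) (dW'_ne S 1) hGR₃ ι₁ (frameD_sign_ι₁' V) (frameD_sign_of_ne V))
      hη₂c (A := Unit)
      (fun _ => finEmb (↥(maximalRealSubfield L)) (Fin 3) x) (fun _ => Ideal.span {(N : 𝓞 ↥(maximalRealSubfield L))})
  exact ⟨n₀, hn₀, fun M hM hdvd k hk Φinf => hfix M hM hdvd k hk () Φinf⟩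

/-- **(D-2) FOR LINE 3 in `U(diag frameD V)(𝔸_f)` currency** (no sign hypothesis: the second line's small character is trivial on `U(V)`). -/
theorem exists_deepFix_threeG (hη₃c : Continuous fun p => ((η₃ p : ℂˣ) : ℂ))
    (x : Fin 3 → ↥(maximalRealSubfield L)) (N : ℕ) :
    ∃ n₀ : ℕ, n₀ ≠ 0 ∧ ∀ M : ℕ, M ≠ 0 → n₀ ∣ M →
      ∀ k ∈ UnitaryGroup.finCongruenceLevel (↥(maximalRealSubfield L)) (L : Type) (IsCMField.complexConj L) 3
          (Matrix.diagonal (frameD V)) (Ideal.span {(M : 𝓞 L)}),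
        ∀ Φinf : 𝓢((Fin 3 → mixedSpace (↥(maximalRealSubfield L))), ℂ),
          cmConjLineRepFin₁ (L : Type) finProdFinEquiv e₁ (frameD V) (frameD_real V) (frameD_ne V) (dW S) (dW_real S) (dW_ne S) (dW' S) (dW'_real S)
              (dW'_ne S) S.isoGL (isoGL_hg₀ S) hGR hGR₂ hGR₃ η₃
              (UnitaryGroup.finAdelicToAdelic (↥(maximalRealSubfield L)) L (IsCMField.complexConj L) 3 (Matrix.diagonal (frameD V)) k, 1)
              (testFun (↥(maximalRealSubfield L)) (Fin 3) Φinf x N) =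
            testFun (↥(maximalRealSubfield L)) (Fin 3) Φinf x N := by
  obtain ⟨n₀, hn₀, hfix⟩ :=
    exists_nat_forall_dvd_finCongruenceLevel_forall_cmConjLineRepFin₁_thinCosetTestFunₗ_eq_self (L : Type) finProdFinEquiv e₁
      (frameD V) (frameD_real V) (frameD_ne V) (dW S) (dW_real S) (dW_ne S) (dW' S) (dW'_real S) (dW'_ne S) S.isoGL (isoGL_hg₀ S)
      hGR hGR₂ hGR₃ η₃
      hη₃c (A := Unit)
      (fun _ => finEmb (↥(maximalRealSubfield L)) (Fin 3) x) (fun _ => Ideal.span {(N : 𝓞 ↥(maximalRealSubfield L))})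
  exact ⟨n₀, hn₀, fun M hM hdvd k hk Φinf => hfix M hM hdvd k hk () Φinf⟩

/-- **the (D-2) index of line 2** (`n₀` of `exists_deepFix_twoG`, chosen). -/
def deepIndexTwoG (hη₂c : Continuous fun p => ((η₂ p : ℂˣ) : ℂ))
    (h₁W : (∀ j, 0 < (ι₁ (dW S j)).re) ∨ ∀ j, (ι₁ (dW S j)).re < 0) (x : Fin 3 → ↥(maximalRealSubfield L)) (N : ℕ) : ℕ :=
  Classical.choose (exists_deepFix_twoG V S hGR hGR₂ hGR₃ η₂ hη₂c h₁W x N)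

/-- (Ported verbatim from the HodgeCMPerL package; no docstring in the source.) -/
theorem deepIndexTwo_ne_zeroG (hη₂c : Continuous fun p => ((η₂ p : ℂˣ) : ℂ))
    (h₁W : (∀ j, 0 < (ι₁ (dW S j)).re) ∨ ∀ j, (ι₁ (dW S j)).re < 0) (x : Fin 3 → ↥(maximalRealSubfield L)) (N : ℕ) :
    deepIndexTwoG V S hGR hGR₂ hGR₃ η₂ hη₂c h₁W x N ≠ 0 :=
  (Classical.choose_spec (exists_deepFix_twoG V S hGR hGR₂ hGR₃ η₂ hη₂c h₁W x N)).1

/-- **the (D-2) index of line 3**. -/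
def deepIndexThreeG (hη₃c : Continuous fun p => ((η₃ p : ℂˣ) : ℂ)) (x : Fin 3 → ↥(maximalRealSubfield L)) (N : ℕ) : ℕ :=
  Classical.choose (exists_deepFix_threeG V S hGR hGR₂ hGR₃ η₃ hη₃c x N)

/-- (Ported verbatim from the HodgeCMPerL package; no docstring in the source.) -/
theorem deepIndexThree_ne_zeroG (hη₃c : Continuous fun p => ((η₃ p : ℂˣ) : ℂ)) (x : Fin 3 → ↥(maximalRealSubfield L)) (N : ℕ) :
    deepIndexThreeG V S hGR hGR₂ hGR₃ η₃ hη₃c x N ≠ 0 :=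
  (Classical.choose_spec (exists_deepFix_threeG V S hGR hGR₂ hGR₃ η₃ hη₃c x N)).1

/-- **`hfin` FOR LINE 2 AT THE PIN on every deep level `deepLevel V M`, `deepIndexTwoG ∣ M`.** -/
theorem hfin_two_deepLevelG (hη₂c : Continuous fun p => ((η₂ p : ℂˣ) : ℂ))
    (h₁W : (∀ j, 0 < (ι₁ (dW S j)).re) ∨ ∀ j, (ι₁ (dW S j)).re < 0) (x : Fin 3 → ↥(maximalRealSubfield L)) (N : ℕ)
    {M : ℕ} (hM : M ≠ 0) (hdvd : deepIndexTwoG V S hGR hGR₂ hGR₃ η₂ hη₂c h₁W x N ∣ M) :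
    ∀ kf : UnitaryGroup.finAdelic (↥(maximalRealSubfield L)) L (IsCMField.complexConj L) 3 V.Hm, kf ∈ (deepLevel V M hM).K →
      ∀ Φinf : 𝓢((Fin 3 → mixedSpace (↥(maximalRealSubfield L))), ℂ),
        lineRepOf V S hGR hGR₀ hGR₁ hGR₂ hGR₃ η₀ η₁ η₂ η₃ 2
            (HodgeCM.Adelic.regimeEquiv L V.Hm hV
              (UnitaryGroup.finAdelicToAdelic (↥(maximalRealSubfield L)) L (IsCMField.complexConj L) 3 V.Hm kf), 1)
            (testFun (↥(maximalRealSubfield L)) (Fin 3) Φinf x N) =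
          testFun (↥(maximalRealSubfield L)) (Fin 3) Φinf x N := by
  intro kf hkf Φinf
  rw [lineRepOf_two_regime_finAdelicG V S hGR hGR₀ hGR₁ hGR₂ hGR₃ η₀ η₁ η₂ η₃ hV kf]
  exact (Classical.choose_spec (exists_deepFix_twoG V S hGR hGR₂ hGR₃ η₂ hη₂c h₁W x N)).2 M hM hdvd _
    (finFrameCongr_mem_of_mem_deepFinLevel V hkf) Φinf

/-- **`hfin` FOR LINE 3 AT THE PIN on every deep level `deepLevel V M`, `deepIndexThreeG ∣ M`.** -/
theorem hfin_three_deepLevelG (hη₃c : Continuous fun p => ((η₃ p : ℂˣ) : ℂ)) (x : Fin 3 → ↥(maximalRealSubfield L)) (N : ℕ)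
    {M : ℕ} (hM : M ≠ 0) (hdvd : deepIndexThreeG V S hGR hGR₂ hGR₃ η₃ hη₃c x N ∣ M) :
    ∀ kf : UnitaryGroup.finAdelic (↥(maximalRealSubfield L)) L (IsCMField.complexConj L) 3 V.Hm, kf ∈ (deepLevel V M hM).K →
      ∀ Φinf : 𝓢((Fin 3 → mixedSpace (↥(maximalRealSubfield L))), ℂ),
        lineRepOf V S hGR hGR₀ hGR₁ hGR₂ hGR₃ η₀ η₁ η₂ η₃ 3
            (HodgeCM.Adelic.regimeEquiv L V.Hm hV
              (UnitaryGroup.finAdelicToAdelic (↥(maximalRealSubfield L)) L (IsCMField.complexConj L) 3 V.Hm kf), 1)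
            (testFun (↥(maximalRealSubfield L)) (Fin 3) Φinf x N) =
          testFun (↥(maximalRealSubfield L)) (Fin 3) Φinf x N := by
  intro kf hkf Φinf
  rw [lineRepOf_three_regime_finAdelicG V S hGR hGR₀ hGR₁ hGR₂ hGR₃ η₀ η₁ η₂ η₃ hV kf]
  exact (Classical.choose_spec (exists_deepFix_threeG V S hGR hGR₂ hGR₃ η₃ hη₃c x N)).2 M hM hdvd _
    (finFrameCongr_mem_of_mem_deepFinLevel V hkf) Φinf

/-! ### the same at an arbitrary thin coset `xc + 𝔫𝒪̂³` (binder-1-g12's currency gap (a)) -/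

/-- **(D-2) FOR LINE 2, ANY THIN COSET, in `U(diag frameD V)(𝔸_f)` currency** (the K-1 twin of the tree theorem at the pin's data; `hV`-free): under the
plane sign `h₁W` at `ι₁` (Weil's majorants, vendored `…CMLinesMajorants` `_of_signs`) and continuity of `η`, for every finite-adelic centre `xc` and level ideal `𝔫` there is `n₀ ≠ 0` such that every `k ∈ K_{U(diag frameD V),f}(M)`, `n₀ ∣ M ≠ 0`, fixes every `φ_N(Φ_∞)` under `cmConjLineRepFin₀ η₂`.
[tree: GelbartRogawski1991 §3.1 Remark p. 457; Weil1964 n° 41 Thm 6] -/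
theorem exists_deepFix_twoCosetG (hη₂c : Continuous fun p => ((η₂ p : ℂˣ) : ℂ))
    (h₁W : (∀ j, 0 < (ι₁ (dW S j)).re) ∨ ∀ j, (ι₁ (dW S j)).re < 0)
    (xc : Fin 3 → FiniteAdeleRing (𝓞 ↥(maximalRealSubfield L)) ↥(maximalRealSubfield L)) (𝔫 : Ideal (𝓞 ↥(maximalRealSubfield L))) :
    ∃ n₀ : ℕ, n₀ ≠ 0 ∧ ∀ M : ℕ, M ≠ 0 → n₀ ∣ M →
      ∀ k ∈ UnitaryGroup.finCongruenceLevel (↥(maximalRealSubfield L)) (L : Type) (IsCMField.complexConj L) 3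
          (Matrix.diagonal (frameD V)) (Ideal.span {(M : 𝓞 L)}),
        ∀ Φinf : 𝓢((Fin 3 → mixedSpace (↥(maximalRealSubfield L))), ℂ),
          cmConjLineRepFin₀ (L : Type) finProdFinEquiv e₁ (frameD V) (frameD_real V) (frameD_ne V) (dW S) (dW_real S) (dW_ne S) (dW' S) (dW'_real S)
              (dW'_ne S) S.isoGL (isoGL_hg₀ S) hGR hGR₂ hGR₃ η₂
              (UnitaryGroup.finAdelicToAdelic (↥(maximalRealSubfield L)) L (IsCMField.complexConj L) 3 (Matrix.diagonal (frameD V)) k, 1)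
              (thinCosetTestFunₗ (K := ↥(maximalRealSubfield L)) (ι := Fin 3) xc 𝔫 Φinf) =
            thinCosetTestFunₗ (K := ↥(maximalRealSubfield L)) (ι := Fin 3) xc 𝔫 Φinf := by
  obtain ⟨n₀, hn₀, hfix⟩ :=
    exists_nat_forall_dvd_finCongruenceLevel_forall_cmConjLineRepFin₀_thinCosetTestFunₗ_eq_self (L : Type) finProdFinEquiv e₁
      (frameD V) (frameD_real V) (frameD_ne V) (dW S) (dW_real S) (dW_ne S) (dW' S) (dW'_real S) (dW'_ne S) S.isoGL (isoGL_hg₀ S)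
      hGR hGR₂ hGR₃ η₂
      (hasThetaMajorants_cmPairSplitting_of_signs_two (L : Type) finProdFinEquiv (frameD V) (frameD_real V) (frameD_ne V) (dW S)
        (dW_real S) (dW_ne S) ι₁ hGR (frameD_sign_ι₁' V) h₁W (frameD_sign_of_ne V))
      (hasThetaMajorants_omega_pairSmall₁_lineVec_of_signs (L : Type) e₁ (frameD V) (frameD_real V) (frameD_ne V) (dW' S 0)
        (dW'_real S 0) (dW'_ne S 0) hGR₂ ι₁ (frameD_sign_ι₁' V) (frameD_sign_of_ne V))
      (hasThetaMajorants_omega_pairSmall₂_lineVec_of_signs (L : Type) e₁ (frameD V) (frameD_real V) (frameD_ne V) (dW' S 1)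
        (dW'_real S 1) (dW'_ne S 1) hGR₃ ι₁ (frameD_sign_ι₁' V) (frameD_sign_of_ne V))
      hη₂c (A := Unit)
      (fun _ => xc) (fun _ => 𝔫)
  exact ⟨n₀, hn₀, fun M hM hdvd k hk Φinf => hfix M hM hdvd k hk () Φinf⟩

/-- **(D-2) FOR LINE 3, ANY THIN COSET, in `U(diag frameD V)(𝔸_f)` currency** (no sign hypothesis: the second line's small character is trivial on `U(V)`). -/
theorem exists_deepFix_threeCosetG (hη₃c : Continuous fun p => ((η₃ p : ℂˣ) : ℂ))
    (xc : Fin 3 → FiniteAdeleRing (𝓞 ↥(maximalRealSubfield L)) ↥(maximalRealSubfield L)) (𝔫 : Ideal (𝓞 ↥(maximalRealSubfield L))) :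
    ∃ n₀ : ℕ, n₀ ≠ 0 ∧ ∀ M : ℕ, M ≠ 0 → n₀ ∣ M →
      ∀ k ∈ UnitaryGroup.finCongruenceLevel (↥(maximalRealSubfield L)) (L : Type) (IsCMField.complexConj L) 3
          (Matrix.diagonal (frameD V)) (Ideal.span {(M : 𝓞 L)}),
        ∀ Φinf : 𝓢((Fin 3 → mixedSpace (↥(maximalRealSubfield L))), ℂ),
          cmConjLineRepFin₁ (L : Type) finProdFinEquiv e₁ (frameD V) (frameD_real V) (frameD_ne V) (dW S) (dW_real S) (dW_ne S) (dW' S) (dW'_real S)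
              (dW'_ne S) S.isoGL (isoGL_hg₀ S) hGR hGR₂ hGR₃ η₃
              (UnitaryGroup.finAdelicToAdelic (↥(maximalRealSubfield L)) L (IsCMField.complexConj L) 3 (Matrix.diagonal (frameD V)) k, 1)
              (thinCosetTestFunₗ (K := ↥(maximalRealSubfield L)) (ι := Fin 3) xc 𝔫 Φinf) =
            thinCosetTestFunₗ (K := ↥(maximalRealSubfield L)) (ι := Fin 3) xc 𝔫 Φinf := by
  obtain ⟨n₀, hn₀, hfix⟩ :=
    exists_nat_forall_dvd_finCongruenceLevel_forall_cmConjLineRepFin₁_thinCosetTestFunₗ_eq_self (L : Type) finProdFinEquiv e₁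
      (frameD V) (frameD_real V) (frameD_ne V) (dW S) (dW_real S) (dW_ne S) (dW' S) (dW'_real S) (dW'_ne S) S.isoGL (isoGL_hg₀ S)
      hGR hGR₂ hGR₃ η₃
      hη₃c (A := Unit)
      (fun _ => xc) (fun _ => 𝔫)
  exact ⟨n₀, hn₀, fun M hM hdvd k hk Φinf => hfix M hM hdvd k hk () Φinf⟩

/-- **the (D-2) index of line 2** (`n₀` of `exists_deepFix_twoCosetG`, chosen). -/
def deepIndexTwoCosetG (hη₂c : Continuous fun p => ((η₂ p : ℂˣ) : ℂ))
    (h₁W : (∀ j, 0 < (ι₁ (dW S j)).re) ∨ ∀ j, (ι₁ (dW S j)).re < 0) (xc : Fin 3 → FiniteAdeleRing (𝓞 ↥(maximalRealSubfield L)) ↥(maximalRealSubfield L)) (𝔫 : Ideal (𝓞 ↥(maximalRealSubfield L))) : ℕ :=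
  Classical.choose (exists_deepFix_twoCosetG V S hGR hGR₂ hGR₃ η₂ hη₂c h₁W xc 𝔫)

/-- (Ported verbatim from the HodgeCMPerL package; no docstring in the source.) -/
theorem deepIndexTwo_ne_zeroCosetG (hη₂c : Continuous fun p => ((η₂ p : ℂˣ) : ℂ))
    (h₁W : (∀ j, 0 < (ι₁ (dW S j)).re) ∨ ∀ j, (ι₁ (dW S j)).re < 0) (xc : Fin 3 → FiniteAdeleRing (𝓞 ↥(maximalRealSubfield L)) ↥(maximalRealSubfield L)) (𝔫 : Ideal (𝓞 ↥(maximalRealSubfield L))) :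
    deepIndexTwoCosetG V S hGR hGR₂ hGR₃ η₂ hη₂c h₁W xc 𝔫 ≠ 0 :=
  (Classical.choose_spec (exists_deepFix_twoCosetG V S hGR hGR₂ hGR₃ η₂ hη₂c h₁W xc 𝔫)).1

/-- **the (D-2) index of line 3**. -/
def deepIndexThreeCosetG (hη₃c : Continuous fun p => ((η₃ p : ℂˣ) : ℂ)) (xc : Fin 3 → FiniteAdeleRing (𝓞 ↥(maximalRealSubfield L)) ↥(maximalRealSubfield L)) (𝔫 : Ideal (𝓞 ↥(maximalRealSubfield L))) : ℕ :=
  Classical.choose (exists_deepFix_threeCosetG V S hGR hGR₂ hGR₃ η₃ hη₃c xc 𝔫)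

/-- (Ported verbatim from the HodgeCMPerL package; no docstring in the source.) -/
theorem deepIndexThree_ne_zeroCosetG (hη₃c : Continuous fun p => ((η₃ p : ℂˣ) : ℂ)) (xc : Fin 3 → FiniteAdeleRing (𝓞 ↥(maximalRealSubfield L)) ↥(maximalRealSubfield L)) (𝔫 : Ideal (𝓞 ↥(maximalRealSubfield L))) :
    deepIndexThreeCosetG V S hGR hGR₂ hGR₃ η₃ hη₃c xc 𝔫 ≠ 0 :=
  (Classical.choose_spec (exists_deepFix_threeCosetG V S hGR hGR₂ hGR₃ η₃ hη₃c xc 𝔫)).1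

/-- **`hfin` FOR LINE 2, ANY THIN COSET, AT THE PIN on every deep level `deepLevel V M`, `deepIndexTwoCosetG ∣ M`.** -/
theorem hfin_two_deepLevelCosetG (hη₂c : Continuous fun p => ((η₂ p : ℂˣ) : ℂ))
    (h₁W : (∀ j, 0 < (ι₁ (dW S j)).re) ∨ ∀ j, (ι₁ (dW S j)).re < 0) (xc : Fin 3 → FiniteAdeleRing (𝓞 ↥(maximalRealSubfield L)) ↥(maximalRealSubfield L)) (𝔫 : Ideal (𝓞 ↥(maximalRealSubfield L)))
    {M : ℕ} (hM : M ≠ 0) (hdvd : deepIndexTwoCosetG V S hGR hGR₂ hGR₃ η₂ hη₂c h₁W xc 𝔫 ∣ M) :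
    ∀ kf : UnitaryGroup.finAdelic (↥(maximalRealSubfield L)) L (IsCMField.complexConj L) 3 V.Hm, kf ∈ (deepLevel V M hM).K →
      ∀ Φinf : 𝓢((Fin 3 → mixedSpace (↥(maximalRealSubfield L))), ℂ),
        lineRepOf V S hGR hGR₀ hGR₁ hGR₂ hGR₃ η₀ η₁ η₂ η₃ 2
            (HodgeCM.Adelic.regimeEquiv L V.Hm hV
              (UnitaryGroup.finAdelicToAdelic (↥(maximalRealSubfield L)) L (IsCMField.complexConj L) 3 V.Hm kf), 1)
            (thinCosetTestFunₗ (K := ↥(maximalRealSubfield L)) (ι := Fin 3) xc 𝔫 Φinf) =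
          thinCosetTestFunₗ (K := ↥(maximalRealSubfield L)) (ι := Fin 3) xc 𝔫 Φinf := by
  intro kf hkf Φinf
  rw [lineRepOf_two_regime_finAdelicG V S hGR hGR₀ hGR₁ hGR₂ hGR₃ η₀ η₁ η₂ η₃ hV kf]
  exact (Classical.choose_spec (exists_deepFix_twoCosetG V S hGR hGR₂ hGR₃ η₂ hη₂c h₁W xc 𝔫)).2 M hM hdvd _
    (finFrameCongr_mem_of_mem_deepFinLevel V hkf) Φinf

/-- **`hfin` FOR LINE 3, ANY THIN COSET, AT THE PIN on every deep level `deepLevel V M`, `deepIndexThreeCosetG ∣ M`.** -/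
theorem hfin_three_deepLevelCosetG (hη₃c : Continuous fun p => ((η₃ p : ℂˣ) : ℂ)) (xc : Fin 3 → FiniteAdeleRing (𝓞 ↥(maximalRealSubfield L)) ↥(maximalRealSubfield L)) (𝔫 : Ideal (𝓞 ↥(maximalRealSubfield L)))
    {M : ℕ} (hM : M ≠ 0) (hdvd : deepIndexThreeCosetG V S hGR hGR₂ hGR₃ η₃ hη₃c xc 𝔫 ∣ M) :
    ∀ kf : UnitaryGroup.finAdelic (↥(maximalRealSubfield L)) L (IsCMField.complexConj L) 3 V.Hm, kf ∈ (deepLevel V M hM).K →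
      ∀ Φinf : 𝓢((Fin 3 → mixedSpace (↥(maximalRealSubfield L))), ℂ),
        lineRepOf V S hGR hGR₀ hGR₁ hGR₂ hGR₃ η₀ η₁ η₂ η₃ 3
            (HodgeCM.Adelic.regimeEquiv L V.Hm hV
              (UnitaryGroup.finAdelicToAdelic (↥(maximalRealSubfield L)) L (IsCMField.complexConj L) 3 V.Hm kf), 1)
            (thinCosetTestFunₗ (K := ↥(maximalRealSubfield L)) (ι := Fin 3) xc 𝔫 Φinf) =
          thinCosetTestFunₗ (K := ↥(maximalRealSubfield L)) (ι := Fin 3) xc 𝔫 Φinf := by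
  intro kf hkf Φinf
  rw [lineRepOf_three_regime_finAdelicG V S hGR hGR₀ hGR₁ hGR₂ hGR₃ η₀ η₁ η₂ η₃ hV kf]
  exact (Classical.choose_spec (exists_deepFix_threeCosetG V S hGR hGR₂ hGR₃ η₃ hη₃c xc 𝔫)).2 M hM hdvd _
    (finFrameCongr_mem_of_mem_deepFinLevel V hkf) Φinf

end FinChar

end HodgeCM.Model

end
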